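import Summits.CriticalPhenomena.PercolationContinuityZ3.Theorems.PercNearOneGluingNoHeavyLowerTailSunflowerCubeGladkovKey
import Mathlib.Combinatorics.Hall.Basic
import Mathlib.LinearAlgebra.Dimension.Constructions
import Mathlib.LinearAlgebra.Dimension.StrongRankCondition
import Mathlib.LinearAlgebra.Matrix.ToLin
import HarnessLib
import HarnessLib.Audit

/-!
# `NoHeavyLowerTail` (crux stmt-CriticalPhenomena-4575), abstract sunflower cubic: the THREE-PETAL CUBE GLADKOV INEQUALITY IN
# GF(2)-RANK AND MARRIAGE FORM, part 2/2 — all cross antipodal pairs of a cube inject SIMULTANEOUSLY into its kernel–bottom pairs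

Support file (seat `prim-l12-p2` gen 18; `--supports stmt-CriticalPhenomena-4575`).  No `sorry`, no new definitions.
Memo: run/shared/lean/prim/prim-l12/prim-l12-p2/FINDING-g18-CUBE-GLADKOV-RANK.md.  Part 1/2 is `…SunflowerCubeGladkovKey` (the identity
`Sunflower.crossKey`); the setting and the statement are recalled there.  This file:
* `Sunflower.cross_kernel_trivial` — the `CR(W) × ABbot(W)` matrix `M(Y,O) = #{R' ∈ B : O ⊆ R' ⊆ Y} (mod 2)` has FULL ROW RANK over `GF(2)`
  (`CR(W)` = cross antipodal pairs of the cube `W` listed by the larger-label side, all three types; `ABbot(W)` = kernel–bottom pairs listed by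
  the bottom side).  Proof: pair a vanishing combination against `N(O,Y″) = #{R ∈ A : τY″ ⊆ R ⊆ τO}`; by `crossKey`, `M·N` is the identity
  off the block (rows `(1|2)`) × (columns `(2|3)`), so first the coefficients of the rows with `lab τY = 1` vanish, then the rest.
* `Sunflower.card_cross_filter_le` — LOCALISED THREE-PETAL GLADKOV: `#(CR(W) ∩ D) ≤ #(ABbot(W) ∩ D)` for every down-set `D`
  (`finrank` count: `M` restricted to `D`-rows is supported on `D`-columns since `M(Y,O) ≠ 0 ⇒ O ⊆ Y`); `D =` everything is antipodal Gladkov.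
* `Sunflower.crossMatching` — MARRIAGE FORM (new): an injection `φ : CR(W) → ABbot(W)` with `φ Y ⊆ Y`, all three cross types at once
  (Hall's theorem on the localised counts).  This is exactly the spectator part of `StarMatching` (`…SunflowerStarMatching`): the demands
  `(i,S,j)` with a fixed spectator block `S` are the cross pairs of the cube `W ∖ S`, their admissible images with `S` kept are its `A|B` pairs.
-/

namespace Summit.CriticalPhenomena.PercolationContinuityZ3.Theorems.SunflowerPartition

open Finset

namespace Sunflower

variable {α : Type*} [DecidableEq α] (F : Sunflower α)

/-! ## Full row rank of `M` on the cross pairs -/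

/-- Two petal labels in increasing order are `(1,2)`, `(1,3)` or `(2,3)`. [folklore] -/
theorem petal_lt_cases (a b : Fin 5) (ha0 : a ≠ 0) (ha4 : a ≠ 4) (hb0 : b ≠ 0) (hb4 : b ≠ 4) (hab : a < b) :
    (a = 1 ∧ (b = 2 ∨ b = 3)) ∨ (a = 2 ∧ b = 3) := by omega

/-- `M(Y,O) = #{R' ∈ B : O ⊆ R' ⊆ Y}` vanishes unless `O ⊆ Y`. [this work] -/
theorem crossM_eq_zero_of_not_subset (W : Finset α) {Y O : Finset α} (h : ¬ O ⊆ Y) :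
    (∑ R' ∈ W.powerset, (if F.lab R' = 0 ∧ O ⊆ R' ∧ R' ⊆ Y then (1 : ZMod 2) else 0)) = 0 :=
  sum_eq_zero fun _ _ => if_neg fun h' => h (h'.2.1.trans h'.2.2)

/-- `M(Y,O)` vanishes unless `lab O = 0`. [this work] -/
theorem crossM_eq_zero_of_lab_ne (W : Finset α) {Y O : Finset α} (h : F.lab O ≠ 0) :
    (∑ R' ∈ W.powerset, (if F.lab R' = 0 ∧ O ⊆ R' ∧ R' ⊆ Y then (1 : ZMod 2) else 0)) = 0 :=
  sum_eq_zero fun _ _ => if_neg fun h' => h (F.lab_eq_zero_of_subset h'.2.1 h'.1)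

/-- `N(O,Y″) = #{R ∈ A : τY″ ⊆ R ⊆ τO}` vanishes unless `lab τO = 4`. [this work] -/
theorem crossN_eq_zero_of_lab_ne (W : Finset α) {Y'' O : Finset α} (h : F.lab (W \ O) ≠ 4) :
    (∑ R ∈ W.powerset, (if F.lab R = 4 ∧ W \ Y'' ⊆ R ∧ R ⊆ W \ O then (1 : ZMod 2) else 0)) = 0 :=
  sum_eq_zero fun _ _ => if_neg fun h' => h (F.lab_eq_four_of_subset h'.2.2 h'.1)

/-- **FULL ROW RANK** (this work).  Let `CR(W) = {Y ⊆ W : lab Y, lab (W∖Y) petals, lab (W∖Y) < lab Y}` (the cross antipodal pairs of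
the cube `W`, each listed by its larger-label side).  If a `GF(2)`-combination `λ` of the rows `M(Y,·) = #{R' ∈ B : · ⊆ R' ⊆ Y}`
(`Y ∈ CR(W)`) vanishes on every kernel–bottom pair `O` (`lab O = 0`, `lab (W∖O) = 4`), then `λ = 0`. [this work] -/
theorem cross_kernel_trivial (W : Finset α) (lam : Finset α → ZMod 2)
    (hlam : ∀ O ∈ W.powerset, F.lab O = 0 → F.lab (W \ O) = 4 →
      (∑ Y ∈ W.powerset.filter (fun Y => F.lab Y ≠ 0 ∧ F.lab Y ≠ 4 ∧ F.lab (W \ Y) ≠ 0 ∧ F.lab (W \ Y) ≠ 4 ∧ F.lab (W \ Y) < F.lab Y),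
        lam Y * (∑ R' ∈ W.powerset, (if F.lab R' = 0 ∧ O ⊆ R' ∧ R' ⊆ Y then (1 : ZMod 2) else 0))) = 0) :
    ∀ Y ∈ W.powerset.filter (fun Y => F.lab Y ≠ 0 ∧ F.lab Y ≠ 4 ∧ F.lab (W \ Y) ≠ 0 ∧ F.lab (W \ Y) ≠ 4 ∧ F.lab (W \ Y) < F.lab Y),
      lam Y = 0 := by
  set CR := W.powerset.filter (fun Y => F.lab Y ≠ 0 ∧ F.lab Y ≠ 4 ∧ F.lab (W \ Y) ≠ 0 ∧ F.lab (W \ Y) ≠ 4 ∧ F.lab (W \ Y) < F.lab Y)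
    with hCR
  have memCR : ∀ {Y}, Y ∈ CR ↔ Y ⊆ W ∧ F.lab Y ≠ 0 ∧ F.lab Y ≠ 4 ∧ F.lab (W \ Y) ≠ 0 ∧ F.lab (W \ Y) ≠ 4 ∧ F.lab (W \ Y) < F.lab Y := by
    intro Y; rw [hCR, mem_filter, mem_powerset]
  -- pair `hlam` against `N(·,Y″)` and exchange: `Σ_Y λ_Y (M·N)(Y,Y″) = 0` for every `Y″`
  have pair : ∀ Y'' : Finset α,
      (∑ Y ∈ CR, lam Y * (∑ O ∈ W.powerset,
        (∑ R' ∈ W.powerset, (if F.lab R' = 0 ∧ O ⊆ R' ∧ R' ⊆ Y then (1 : ZMod 2) else 0)) *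
        (∑ R ∈ W.powerset, (if F.lab R = 4 ∧ W \ Y'' ⊆ R ∧ R ⊆ W \ O then (1 : ZMod 2) else 0)))) = 0 := by
    intro Y''
    have hO : ∀ O ∈ W.powerset,
        (∑ Y ∈ CR, lam Y * (∑ R' ∈ W.powerset, (if F.lab R' = 0 ∧ O ⊆ R' ∧ R' ⊆ Y then (1 : ZMod 2) else 0))) *
          (∑ R ∈ W.powerset, (if F.lab R = 4 ∧ W \ Y'' ⊆ R ∧ R ⊆ W \ O then (1 : ZMod 2) else 0)) = 0 := by
      intro O hO
      by_cases h0 : F.lab O = 0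
      · by_cases h4 : F.lab (W \ O) = 4
        · rw [hlam O hO h0 h4, zero_mul]
        · rw [F.crossN_eq_zero_of_lab_ne W h4, mul_zero]
      · rw [show (∑ Y ∈ CR, lam Y * (∑ R' ∈ W.powerset, (if F.lab R' = 0 ∧ O ⊆ R' ∧ R' ⊆ Y then (1 : ZMod 2) else 0))) = 0 from
          sum_eq_zero fun Y _ => by rw [F.crossM_eq_zero_of_lab_ne W h0, mul_zero], zero_mul]
    calc (∑ Y ∈ CR, lam Y * (∑ O ∈ W.powerset,
          (∑ R' ∈ W.powerset, (if F.lab R' = 0 ∧ O ⊆ R' ∧ R' ⊆ Y then (1 : ZMod 2) else 0)) *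
          (∑ R ∈ W.powerset, (if F.lab R = 4 ∧ W \ Y'' ⊆ R ∧ R ⊆ W \ O then (1 : ZMod 2) else 0))))
        = ∑ O ∈ W.powerset, (∑ Y ∈ CR, lam Y *
            (∑ R' ∈ W.powerset, (if F.lab R' = 0 ∧ O ⊆ R' ∧ R' ⊆ Y then (1 : ZMod 2) else 0))) *
            (∑ R ∈ W.powerset, (if F.lab R = 4 ∧ W \ Y'' ⊆ R ∧ R ⊆ W \ O then (1 : ZMod 2) else 0)) := by
          rw [show (∑ Y ∈ CR, lam Y * (∑ O ∈ W.powerset,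
              (∑ R' ∈ W.powerset, (if F.lab R' = 0 ∧ O ⊆ R' ∧ R' ⊆ Y then (1 : ZMod 2) else 0)) *
              (∑ R ∈ W.powerset, (if F.lab R = 4 ∧ W \ Y'' ⊆ R ∧ R ⊆ W \ O then (1 : ZMod 2) else 0))))
            = ∑ Y ∈ CR, ∑ O ∈ W.powerset, lam Y *
              ((∑ R' ∈ W.powerset, (if F.lab R' = 0 ∧ O ⊆ R' ∧ R' ⊆ Y then (1 : ZMod 2) else 0)) *
              (∑ R ∈ W.powerset, (if F.lab R = 4 ∧ W \ Y'' ⊆ R ∧ R ⊆ W \ O then (1 : ZMod 2) else 0))) from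
            sum_congr rfl fun Y _ => Finset.mul_sum _ _ _]
          rw [Finset.sum_comm]
          refine sum_congr rfl fun O _ => ?_
          rw [Finset.sum_mul]
          exact sum_congr rfl fun Y _ => by ring
      _ = 0 := sum_eq_zero hO
  -- step 1: rows with `lab (W ∖ Y″) = 1`
  have step1 : ∀ Y'' ∈ CR, F.lab (W \ Y'') = 1 → lam Y'' = 0 := by
    intro Y'' hY'' h1
    obtain ⟨hY''W, hY''0, hY''4, hc0, hc4, -⟩ := memCR.1 hY''
    have h := pair Y''
    rw [show (∑ Y ∈ CR, lam Y * (∑ O ∈ W.powerset,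
          (∑ R' ∈ W.powerset, (if F.lab R' = 0 ∧ O ⊆ R' ∧ R' ⊆ Y then (1 : ZMod 2) else 0)) *
          (∑ R ∈ W.powerset, (if F.lab R = 4 ∧ W \ Y'' ⊆ R ∧ R ⊆ W \ O then (1 : ZMod 2) else 0))))
        = ∑ Y ∈ CR, (if Y = Y'' then lam Y else 0) by
      refine sum_congr rfl fun Y hY => ?_
      obtain ⟨hYW, hY0, hY4, hcY0, hcY4, hlt⟩ := memCR.1 hY
      have hne : F.lab (W \ Y'') ≠ F.lab Y := by
        rw [h1]
        rcases petal_lt_cases _ _ hcY0 hcY4 hY0 hY4 hlt with ⟨-, h | h⟩ | ⟨-, h⟩ <;> rw [h] <;> decide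
      rw [F.crossKey W hYW hY''W hY4 hcY4 hY''0 hc0 hc4 hne, mul_ite, mul_one, mul_zero]] at h
    rwa [Finset.sum_ite_eq' CR Y'' lam, if_pos hY''] at h
  -- step 2: the remaining rows have `lab (W ∖ Y″) = 2`, `lab Y″ = 3`
  intro Y'' hY''
  obtain ⟨hY''W, hY''0, hY''4, hc0, hc4, hlt''⟩ := memCR.1 hY''
  rcases petal_lt_cases _ _ hc0 hc4 hY''0 hY''4 hlt'' with ⟨h1, -⟩ | ⟨h2, h3⟩
  · exact step1 Y'' hY'' h1
  have h := pair Y''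
  rw [show (∑ Y ∈ CR, lam Y * (∑ O ∈ W.powerset,
        (∑ R' ∈ W.powerset, (if F.lab R' = 0 ∧ O ⊆ R' ∧ R' ⊆ Y then (1 : ZMod 2) else 0)) *
        (∑ R ∈ W.powerset, (if F.lab R = 4 ∧ W \ Y'' ⊆ R ∧ R ⊆ W \ O then (1 : ZMod 2) else 0))))
      = ∑ Y ∈ CR, (if Y = Y'' then lam Y else 0) by
    refine sum_congr rfl fun Y hY => ?_
    obtain ⟨hYW, hY0, hY4, hcY0, hcY4, hlt⟩ := memCR.1 hY
    rcases petal_lt_cases _ _ hcY0 hcY4 hY0 hY4 hlt with ⟨hc1, -⟩ | ⟨hc2, hY3⟩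
    · -- `lab (W ∖ Y) = 1`: coefficient already zero
      rw [step1 Y hY hc1, zero_mul, if_neg]
      rintro rfl
      rw [hc1] at h2; exact absurd h2 (by decide)
    · have hne : F.lab (W \ Y'') ≠ F.lab Y := by rw [h2, hY3]; decide
      rw [F.crossKey W hYW hY''W hY4 hcY4 hY''0 hc0 hc4 hne, mul_ite, mul_one, mul_zero]] at h
  rwa [Finset.sum_ite_eq' CR Y'' lam, if_pos hY''] at h

/-! ## Consequences: localised three-petal Gladkov and the marriage form -/

/-- **LOCALISED THREE-PETAL GLADKOV** (this work): for every down-set `D` of sets, the cross pairs of the cube `W` whose larger-label side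
lies in `D` are at most as many as the kernel–bottom pairs whose bottom side lies in `D`:
`#(CR(W) ∩ D) ≤ #{O ∈ D : O ⊆ W, lab O = 0, lab (W∖O) = 4}`.  (`D = ` everything is the antipodal Gladkov count.) [this work] -/
theorem card_cross_filter_le (W : Finset α) (D : Finset (Finset α)) (hD : IsLowerSet (D : Set (Finset α))) :
    ((W.powerset.filter (fun Y => F.lab Y ≠ 0 ∧ F.lab Y ≠ 4 ∧ F.lab (W \ Y) ≠ 0 ∧ F.lab (W \ Y) ≠ 4 ∧ F.lab (W \ Y) < F.lab Y)).filter
        (· ∈ D)).card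
      ≤ ((W.powerset.filter (fun O => F.lab O = 0 ∧ F.lab (W \ O) = 4)).filter (· ∈ D)).card := by
  classical
  set CR := W.powerset.filter (fun Y => F.lab Y ≠ 0 ∧ F.lab Y ≠ 4 ∧ F.lab (W \ Y) ≠ 0 ∧ F.lab (W \ Y) ≠ 4 ∧ F.lab (W \ Y) < F.lab Y)
    with hCR
  set AB := W.powerset.filter (fun O => F.lab O = 0 ∧ F.lab (W \ O) = 4) with hAB
  set P := CR.filter (· ∈ D) with hP
  set Nn := AB.filter (· ∈ D) with hNn
  let Mx : Matrix Nn P (ZMod 2) := Matrix.of fun O Y =>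
    ∑ R' ∈ W.powerset, (if F.lab R' = 0 ∧ (O.1 : Finset α) ⊆ R' ∧ R' ⊆ Y.1 then (1 : ZMod 2) else 0)
  have hinj : Function.Injective (Matrix.mulVecLin Mx) := by
    rw [← LinearMap.ker_eq_bot, LinearMap.ker_eq_bot']
    intro g hg
    let lam : Finset α → ZMod 2 := fun Y => if h : Y ∈ P then g ⟨Y, h⟩ else 0
    have hlamP : ∀ x : P, g x = lam x.1 := fun x => by simp only [lam, dif_pos x.2]
    have hlam0 : ∀ Y, Y ∉ P → lam Y = 0 := fun Y hY => by simp only [lam, dif_neg hY]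
    have hlam : ∀ O ∈ W.powerset, F.lab O = 0 → F.lab (W \ O) = 4 →
        (∑ Y ∈ CR, lam Y * (∑ R' ∈ W.powerset, (if F.lab R' = 0 ∧ O ⊆ R' ∧ R' ⊆ Y then (1 : ZMod 2) else 0))) = 0 := by
      intro O hO h0 h4
      have hsum : (∑ Y ∈ CR, lam Y * (∑ R' ∈ W.powerset, (if F.lab R' = 0 ∧ O ⊆ R' ∧ R' ⊆ Y then (1 : ZMod 2) else 0)))
          = ∑ Y ∈ P, lam Y * (∑ R' ∈ W.powerset, (if F.lab R' = 0 ∧ O ⊆ R' ∧ R' ⊆ Y then (1 : ZMod 2) else 0)) := by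
        conv_rhs => rw [hP, Finset.sum_filter]
        refine sum_congr rfl fun Y hY => ?_
        by_cases hYD : Y ∈ D
        · rw [if_pos hYD]
        · rw [if_neg hYD, hlam0 Y (fun h => hYD (mem_filter.1 h).2), zero_mul]
      rw [hsum]
      by_cases hOD : O ∈ D
      · have hO' : O ∈ Nn := mem_filter.2 ⟨mem_filter.2 ⟨hO, h0, h4⟩, hOD⟩
        have h0' : (Mx.mulVec g) ⟨O, hO'⟩ = 0 :=
          congrFun (show Mx.mulVec g = 0 from (Matrix.mulVecLin_apply Mx g).symm.trans hg) ⟨O, hO'⟩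
        simp only [Matrix.mulVec, dotProduct, Mx, Matrix.of_apply] at h0'
        rw [← Finset.sum_coe_sort P]
        refine Eq.trans (sum_congr rfl fun x _ => ?_) h0'
        rw [hlamP x, mul_comm]
      · refine sum_eq_zero fun Y hY => ?_
        rw [F.crossM_eq_zero_of_not_subset W (fun hOY => hOD (hD hOY (mem_filter.1 hY).2)), mul_zero]
    have hz := F.cross_kernel_trivial W lam hlam
    funext x
    rw [hlamP x, Pi.zero_apply]
    exact hz x.1 (mem_filter.1 x.2).1
  have hle := LinearMap.finrank_le_finrank_of_injective hinj
  rw [Module.finrank_fintype_fun_eq_card, Module.finrank_fintype_fun_eq_card, Fintype.card_coe, Fintype.card_coe] at hle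
  exact hle

/-- **THREE-PETAL CUBE GLADKOV, MARRIAGE FORM** (this work): the cross antipodal pairs of a cube `W` — all three types, each listed by
its larger-label side `Y` — inject into the kernel–bottom antipodal pairs of `W` along containment: there is `φ`, injective on `CR(W)`,
with `φ Y ⊆ Y`, `lab (φ Y) = 0`, `lab (W ∖ φ Y) = 4`. [this work] -/
theorem crossMatching (W : Finset α) :
    ∃ φ : Finset α → Finset α,
      Set.InjOn φ (W.powerset.filter (fun Y => F.lab Y ≠ 0 ∧ F.lab Y ≠ 4 ∧ F.lab (W \ Y) ≠ 0 ∧ F.lab (W \ Y) ≠ 4 ∧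
        F.lab (W \ Y) < F.lab Y) : Set (Finset α)) ∧
      ∀ Y ∈ W.powerset.filter (fun Y => F.lab Y ≠ 0 ∧ F.lab Y ≠ 4 ∧ F.lab (W \ Y) ≠ 0 ∧ F.lab (W \ Y) ≠ 4 ∧ F.lab (W \ Y) < F.lab Y),
        φ Y ∈ W.powerset.filter (fun O => F.lab O = 0 ∧ F.lab (W \ O) = 4) ∧ φ Y ⊆ Y := by
  classical
  set P := W.powerset.filter (fun Y => F.lab Y ≠ 0 ∧ F.lab Y ≠ 4 ∧ F.lab (W \ Y) ≠ 0 ∧ F.lab (W \ Y) ≠ 4 ∧ F.lab (W \ Y) < F.lab Y)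
    with hP
  set N := W.powerset.filter (fun O => F.lab O = 0 ∧ F.lab (W \ O) = 4) with hN
  have hall : ∀ s : Finset P, s.card ≤ (s.biUnion fun T => N.filter (· ⊆ (T.1 : Finset α))).card := by
    intro s
    let D : Finset (Finset α) := (s.image Subtype.val).biUnion fun T => T.powerset
    have hD : IsLowerSet (D : Set (Finset α)) := HallGladkov.isLowerSet_biUnion_powerset _
    have key := F.card_cross_filter_le W D hD
    have h1 : s.card ≤ (P.filter (· ∈ D)).card := by
      rw [← Finset.card_image_of_injective s Subtype.val_injective]
      refine card_le_card fun T hT => ?_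
      obtain ⟨x, hx, rfl⟩ := mem_image.1 hT
      exact mem_filter.2 ⟨x.2, mem_biUnion.2 ⟨x.1, mem_image.2 ⟨x, hx, rfl⟩, mem_powerset.2 subset_rfl⟩⟩
    have h2 : N.filter (· ∈ D) = s.biUnion fun T => N.filter (· ⊆ (T.1 : Finset α)) := by
      ext O
      constructor
      · intro hO
        obtain ⟨hON, hOD⟩ := mem_filter.1 hO
        obtain ⟨T, hT, hOT⟩ := mem_biUnion.1 hOD
        obtain ⟨x, hx, rfl⟩ := mem_image.1 hT
        exact mem_biUnion.2 ⟨x, hx, mem_filter.2 ⟨hON, mem_powerset.1 hOT⟩⟩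
      · intro hO
        obtain ⟨x, hx, hOx⟩ := mem_biUnion.1 hO
        exact mem_filter.2 ⟨(mem_filter.1 hOx).1,
          mem_biUnion.2 ⟨x.1, mem_image.2 ⟨x, hx, rfl⟩, mem_powerset.2 (mem_filter.1 hOx).2⟩⟩
    rw [← h2]
    exact le_trans h1 key
  obtain ⟨f, hf, hf2⟩ := (Finset.all_card_le_biUnion_card_iff_exists_injective _).1 hall
  refine ⟨fun T => if hT : T ∈ P then (f ⟨T, hT⟩ : Finset α) else ∅, ?_, ?_⟩
  · intro T hT T' hT' hTT'
    have hTP : T ∈ P := hT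
    have hTP' : T' ∈ P := hT'
    have e : f ⟨T, hTP⟩ = f ⟨T', hTP'⟩ := by simpa only [dif_pos hTP, dif_pos hTP'] using hTT'
    exact congrArg Subtype.val (hf e)
  · intro T hT
    have hTP : T ∈ P := hT
    simp only [dif_pos hTP]
    exact mem_filter.1 (hf2 ⟨T, hTP⟩)

end Sunflower

end Summit.CriticalPhenomena.PercolationContinuityZ3.Theorems.SunflowerPartition
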